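import Literature.MathematicalPhysics.QuantumLattice.HubbardHubbardModelEtaODLROProofs

/-!
# Crux `TwSeededEnsembleEquivalence` (stmt-HubbardSuperconductivity-1698), line `exposed-density-duality` —
# structural barrier, stub B2 `stub_etaTowerTrialState`

YANG'S `η`-TOWER STATES ARE EXACT EIGENVECTORS OF THE SEEDED ATOMIC-LIMIT HUBBARD TORUS. For the
atomic limit (`t = 0`) of the Hubbard torus `(ℤ/Lℤ)²` with the on-site `s`-wave seed,
`HsCan = hubbardTorus 2 L 0 U − (g/L²) (pairField sWave L)ᴴ (pairField sWave L)`, the tower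
states `ψ_m = (η†)^m |0⟩ = etaPairingState 1 m` (`η† = Σ_x c†_{x↑} c†_{x↓}`, unstaggered sign
`ε ≡ 1`) satisfy, for `m ≤ L²`,

* `ψ_m ≠ 0` and `ψ_m` has `2m` particles (`etaPairingState_ne_zero`,
  `isNParticle_etaPairingState_holds`);
* `HsCan ψ_m = (U m − (g/L²) · 2m (L² − m + 1)) ψ_m`.

Ingredients: (i) with `t = 0` the hopping term vanishes, so `hubbardTorus 2 L 0 U` is the Hubbard
Hamiltonian of the EMPTY graph, on which Yang's sign condition is vacuous and
`hamiltonian_mulVec_etaPairingState` gives `U D̂ ψ_m = m U ψ_m`; (ii) the normal form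
`pairField sWave L = −√2 · η` (only the `e = 0` step of `localPair` survives, `c_{x↑}c_{x↓} = −c_{x↓}c_{x↑}`),
hence `(pairField sWave L)ᴴ (pairField sWave L) = 2 η†η`; (iii) the ladder relation
`η ψ_{m+1} = (m+1)(L² − m) ψ_m` (`etaLower_mulVec_etaPairingState_succ`), so `η†η ψ_m = m(L² − m + 1) ψ_m`.

Sources: C. N. Yang, PRL **63** (1989) 2144, eqs. (4)–(11); C. N. Yang, S. C. Zhang, Mod. Phys.
Lett. B **4** (1990) 759, Theorem 1. Elementary CAR bookkeeping; no definitions are introduced.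
-/

-- the tree's layout `Summit.HubbardSuperconductivity.HubbardSuperconductivity.…` repeats a namespace component
set_option linter.dupNamespace false

noncomputable section

namespace Summit.HubbardSuperconductivity.HubbardSuperconductivity.Theorems.TwSeededEnsembleEquivalence.ExposedDensity

open Matrix Finset Literature.MathematicalPhysics.QuantumLattice Literature.Probability.LatticeModels
open Literature.MathematicalPhysics.QuantumLattice.EtaPairingODLRO
open scoped ComplexOrder Matrix.Norms.L2Operator

/-! ### The atomic-limit Hubbard torus on the `η` tower -/

/-- With hopping `t = 0` the Hubbard torus Hamiltonian is the Hubbard Hamiltonian of the empty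
graph: both are `U Σ_x n_{x↑} n_{x↓}`. [folklore] -/
theorem etaTower_hubbardTorus_zero_eq_hamiltonian_bot (L : ℕ) (U : ℝ) :
    hubbardTorus 2 L 0 U = hamiltonian (⊥ : SimpleGraph (FermionTorus 2 L)) 0 U := by
  simp [hubbardTorus, hamiltonian]

/-- `U D̂ ψ_m = m U ψ_m` for the atomic-limit torus and ANY sign `ε` (Yang's eigenvalue equation
on the empty graph, where the bipartite sign condition is vacuous).
Yang, PRL 63 (1989) 2144, eq. (8). [cite: Yang1989, eq. (8)] -/
theorem etaTower_hubbardTorus_zero_mulVec (L : ℕ) (U : ℝ) (ε : FermionTorus 2 L → ℤˣ) (m : ℕ) :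
    hubbardTorus 2 L 0 U *ᵥ etaPairingState ε m = ((m * U : ℝ) : ℂ) • etaPairingState ε m := by
  rw [etaTower_hubbardTorus_zero_eq_hamiltonian_bot]
  exact hamiltonian_mulVec_etaPairingState ⊥ ε
    (fun x y h => ((SimpleGraph.bot_adj x y).1 h).elim) 0 U m

/-- `η†η ψ_m = m (|Λ| − m + 1) ψ_m` for `ψ_m = (η†)^m |0⟩` (from the ladder relation
`η ψ_{m+1} = (m+1)(|Λ| − m) ψ_m` and `η |0⟩ = 0`).
Yang–Zhang, Mod. Phys. Lett. B 4 (1990) 759, Theorem 1 and §4. [cite: YangZhang1990, Theorem 1] -/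
theorem etaTower_etaRaise_mul_etaLower_mulVec {Λ : Type*} [LinearOrder Λ] [Fintype Λ]
    (ε : Λ → ℤˣ) (m : ℕ) :
    (etaRaise ε * etaLower ε) *ᵥ etaPairingState ε m =
      ((m : ℂ) * ((Fintype.card Λ : ℂ) - m + 1)) • etaPairingState ε m := by
  cases m with
  | zero =>
    rw [← mulVec_mulVec, etaPairingState_zero, etaLower_mulVec_vacuum, mulVec_zero]
    simp
  | succ m =>
    rw [← mulVec_mulVec, etaLower_mulVec_etaPairingState_succ, mulVec_smul, ← etaPairingState_succ]
    congr 1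
    push_cast
    ring

/-! ### The on-site pair field is `−√2 · η` -/

/-- `Torus.proj L 0 = 0`. [folklore] -/
theorem etaTower_torusProj_zero (L : ℕ) : Torus.proj L (0 : Site 2) = 0 := by
  funext i
  simp [Torus.proj]

/-- The `e = 0` term of `localPair sWave`: `(1/√2)(c_{y↑} c_{y↓} − c_{y↓} c_{y↑}) = −√2 · c_{y↓} c_{y↑}`
(CAR: `c_{y↑} c_{y↓} = −c_{y↓} c_{y↑}`). Scalapino, Phys. Rep. 250 (1995) 329, §2. [folklore] -/
theorem etaTower_onsitePair_eq (L : ℕ) (y : FermionTorus 2 L) :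
    ((sWave 0 / Real.sqrt 2 : ℝ) : ℂ) •
        (annihilation (orb y 0) * annihilation (orb y 1) -
          annihilation (orb y 1) * annihilation (orb y 0)) =
      (-((Real.sqrt 2 : ℝ) : ℂ)) • (annihilation (orb y 1) * annihilation (orb y 0)) := by
  have hcar : annihilation (orb y 0) * annihilation (orb y 1) =
      -(annihilation (orb y 1) * annihilation (orb y 0)) :=
    eq_neg_of_add_eq_zero_left (annihilation_anticommute_holds (orb y 0) (orb y 1))
  have hs : sWave 0 = 1 := if_pos rfl
  have h2 : ((1 / Real.sqrt 2 : ℝ) : ℂ) * 2 = ((Real.sqrt 2 : ℝ) : ℂ) := by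
    have h : (1 / Real.sqrt 2 : ℝ) * 2 = Real.sqrt 2 := by
      rw [div_mul_eq_mul_div, one_mul, div_eq_iff (Real.sqrt_ne_zero'.2 two_pos)]
      exact (Real.mul_self_sqrt zero_le_two).symm
    exact_mod_cast h
  rw [hcar, hs, ← neg_add', ← two_smul ℂ, smul_neg, ← neg_smul, smul_smul, neg_mul, h2]

/-- **Normal form of the on-site pair field**: `pairField sWave L = −√2 · η₁`, `η₁ = etaLower 1 = Σ_x c_{x↓} c_{x↑}`
(the unit-step terms of `localPair` carry `sWave e = 0`; reindex `TorusSite 2 L ≃ FermionTorus 2 L`).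
Scalapino, Phys. Rep. 250 (1995) 329, §2; Yang, PRL 63 (1989) 2144, eq. (4). [folklore] -/
theorem etaTower_pairField_sWave_eq (L : ℕ) [NeZero L] :
    pairField sWave L =
      (-((Real.sqrt 2 : ℝ) : ℂ)) • etaLower (fun _ : FermionTorus 2 L => (1 : ℤˣ)) := by
  have h1 : pairField sWave L = ∑ x : TorusSite 2 L, (-((Real.sqrt 2 : ℝ) : ℂ)) •
      (annihilation (orb (FermionTorus.ofTorusSite x) 1) *
        annihilation (orb (FermionTorus.ofTorusSite x) 0)) := by
    unfold pairField localPair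
    refine Finset.sum_congr rfl fun x _ => ?_
    rw [Finset.sum_eq_single_of_mem (0 : Site 2) (Finset.mem_insert_self _ _) fun e _ hne => by
      rw [show sWave e = 0 from if_neg hne, zero_div, Complex.ofReal_zero, zero_smul]]
    rw [etaTower_torusProj_zero, add_zero, etaTower_onsitePair_eq]
  have h2 : ∑ x : TorusSite 2 L, (-((Real.sqrt 2 : ℝ) : ℂ)) •
      (annihilation (orb (FermionTorus.ofTorusSite x) 1) *
        annihilation (orb (FermionTorus.ofTorusSite x) 0)) =
      ∑ y : FermionTorus 2 L, (-((Real.sqrt 2 : ℝ) : ℂ)) •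
        (annihilation (orb y 1) * annihilation (orb y 0)) :=
    Fintype.sum_equiv FermionTorus.equivTorusSite.symm _ _ fun _ => rfl
  rw [h1, h2, ← Finset.smul_sum, etaLower_eq_sum']
  congr 1
  refine Finset.sum_congr rfl fun y _ => ?_
  rw [Units.val_one, Int.cast_one, one_smul]

/-- `(pairField sWave L)ᴴ (pairField sWave L) = 2 η₁† η₁` (`(−√2)² = 2`, `ηᴴ = η†`).
Yang, PRL 63 (1989) 2144, eq. (4); Scalapino, Phys. Rep. 250 (1995) 329, §2. [folklore] -/
theorem etaTower_pairField_conjTranspose_mul_self (L : ℕ) [NeZero L] :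
    (pairField sWave L)ᴴ * pairField sWave L =
      (2 : ℂ) • (etaRaise (fun _ : FermionTorus 2 L => (1 : ℤˣ)) * etaLower (fun _ => 1)) := by
  have hct : (etaLower (fun _ : FermionTorus 2 L => (1 : ℤˣ)))ᴴ = etaRaise (fun _ => 1) :=
    conjTranspose_conjTranspose _
  have hsc : star (-((Real.sqrt 2 : ℝ) : ℂ)) * (-((Real.sqrt 2 : ℝ) : ℂ)) = 2 := by
    rw [star_neg, Complex.star_def, Complex.conj_ofReal, neg_mul_neg, ← Complex.ofReal_mul,
      Real.mul_self_sqrt zero_le_two, Complex.ofReal_ofNat]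
  rw [etaTower_pairField_sWave_eq, conjTranspose_smul, hct, Matrix.smul_mul, Matrix.mul_smul,
    smul_smul, hsc]

/-! ### The stub -/

/-- **Barrier stub B2 — Yang's `η`-tower states are exact eigenvectors of the seeded atomic model.**
For `m ≤ L²`, `ψ_m = (η†)^m |0⟩ = etaPairingState 1 m` on the fermionic torus `(ℤ/Lℤ)²` is nonzero,
has `2m` particles, and
`(hubbardTorus 2 L 0 U − (g/L²)(pairField sWave L)ᴴ(pairField sWave L)) ψ_m = (U m − (g/L²)·2m(L² − m + 1)) ψ_m`
(`U D̂ ψ_m = m U ψ_m` on the empty graph; `(pairField sWave L)ᴴ(pairField sWave L) = 2 η†η`;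
`η†η ψ_m = m(L² − m + 1) ψ_m`). Yang, PRL 63 (1989) 2144, eqs. (7)–(11); Yang–Zhang,
Mod. Phys. Lett. B 4 (1990) 759, Theorem 1. [cite: Yang1989, eqs. (7)–(11)] -/
theorem stub_etaTowerTrialState :
    ∀ (L : ℕ) [NeZero L] (U g : ℝ) (m : ℕ), m ≤ L ^ 2 →
      etaPairingState (fun _ : FermionTorus 2 L => (1 : ℤˣ)) m ≠ 0 ∧
      IsNParticle (2 * m) (etaPairingState (fun _ : FermionTorus 2 L => (1 : ℤˣ)) m) ∧
      (hubbardTorus 2 L 0 U - ((g / (L : ℝ) ^ 2 : ℝ) : ℂ) • ((pairField sWave L)ᴴ * pairField sWave L)) *ᵥ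
          etaPairingState (fun _ : FermionTorus 2 L => (1 : ℤˣ)) m =
        (((U * m - g / (L : ℝ) ^ 2 * (2 * m * ((L : ℝ) ^ 2 - m + 1))) : ℝ) : ℂ) •
          etaPairingState (fun _ : FermionTorus 2 L => (1 : ℤˣ)) m := by
  intro L _ U g m hm
  refine ⟨etaPairingState_ne_zero _ (by rw [card_fermionTorus]; exact hm),
    isNParticle_etaPairingState_holds _ m, ?_⟩
  rw [sub_mulVec, smul_mulVec, etaTower_pairField_conjTranspose_mul_self, smul_mulVec,
    etaTower_etaRaise_mul_etaLower_mulVec, etaTower_hubbardTorus_zero_mulVec, smul_smul, smul_smul,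
    ← sub_smul, card_fermionTorus]
  congr 1
  push_cast
  ring

end Summit.HubbardSuperconductivity.HubbardSuperconductivity.Theorems.TwSeededEnsembleEquivalence.ExposedDensity

end
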